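/-
Copyright: lit-balaban Phase-2 proof seat p30 (gen 9).  Statement-level skeleton of a published paper; no proof claims beyond what
the kernel checks below.
-/
import Literature.MathematicalPhysics.QuantumFieldTheory.BalabanImbrieJaffe1984to88.BIJ85ResidualConstants
import Literature.MathematicalPhysics.QuantumFieldTheory.BalabanImbrieJaffe1984to88.BIJ85Claim73Closed

/-!
# [BalabanImbrieJaffe1985] (4.2.6): the residual field of a NON-closed unit field is NOT small — `max|f_k(δ_q)| ≥ L^{2k}/6`

T. Bałaban, J. Imbrie, A. Jaffe, *Renormalization of the Higgs model: minimizers, propagators and the stability of mean field theory*,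
Commun. Math. Phys. **97** (1985) 299–329 [BalabanImbrieJaffe1985].  Row **C1.Eq7.3.1-7.3.2** of the lit-balaban skeleton — the
NEGATIVE COMPANION of the `K_R` discharge (`BIJ85ResidualSupBound`, CLOSED fields): why the located input of the residual route must be
stated for CLOSED unit-lattice plaquette fields (p33's `BIJ85Claim73Closed.ClosedIdx.hR`), exactly as the printed text presupposes
(p. 326 [PDF 28]: *"f^{(k)} can locally be represented as a curl"*), and not for all fields (p33's earlier `BIJ85Claim73Residual.ResIdx.hR`).

THE FACT.  The residual field (4.2.6) `f_k = (I − ∂G_{k,Ax}∂^*)Q^{e*}_kf` subtracts from `Q^{e*}_kf` its orthogonal projection onto the curls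
`∂V` (§4.1–4.2, p. 309–311).  Every curl is CLOSED (`d∂ = 0`, p33's `dPlaq_curl`), so the lattice exterior derivative `d` of `f_k` equals that
of `Q^{e*}_kf` — and for the unit field `f = δ_q` concentrated on ONE unit plaquette `q` of type `(01)` (`d ≥ 3`), `Q^{e*}_kδ_q` carries the value
`L^{2k}` on the `L^k` junction plaquettes of `q` ((2.22), p33 g6 `QestarIter_blockSiteK`) and `(dQ^{e*}_kδ_q)_{012}(x₀) = −L^{2k}` at the
corner cube `x₀` of the block (`dPlaq_QesOp_single`).  Since `(dF)_{012}(x₀)` is a signed sum of six values of `F`,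
**`max_p|f_k(δ_q)(p)| ≥ L^{2k}/6`** (`exists_abs_resE_single_ge`), although `max|δ_q| = 1`.  Consequently a constant `K` with
`|f_k(g)(p)| ≤ K·max|g|` for ALL unit fields `g` at scale `k` satisfies **`K ≥ L^{2k}/6`** (`sq_le_of_resBound_all`,
`sq_le_of_resBound_all_eta` in p33's normalisation): no such `K` is uniform in `k`.  For CLOSED `g` the flux through every cube vanishes
and `K_R = O(1)` (`BIJ85ResidualSupBound.exists_KR_of_ineq722`).

WHAT IS PROVED (0 `sorry`, theorems only, no `def`, no new named fact; standing range `k ≤ m + K`, `3 ≤ d`, `w > 0`, `c ≠ 0`).  statement-level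
skeleton of published theorems with citation tags; proofs where landed; nothing here is a claim about the Yang–Mills mass gap.
Unit `lit-balaban-p30` (literature-prover-lit-balaban-p30-g9-0), 2026-08-21.
-/

open scoped BigOperators RealInnerProductSpace

namespace Literature.MathematicalPhysics.QuantumFieldTheory.BalabanImbrieJaffe1984to88.BIJ85ResidualNonClosed

open Balaban1983to89 hiding Site Plaq
open Balaban1983to89.LatticeFieldCalculus
open Balaban1983to89.B5Eq118OneStroke (iterBlockOf)
open Balaban1983to89.B5Eq117TorusCarriers (blockSiteK)
open BIJ85AxialPropagator411 BIJ85Prop521Torus BIJ85Sigma421Torus BIJ85SigmaForm421 BIJ85Sigma422Eta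
open BIJ85Eq531Inputs (QestarIter)
open BIJ85Thm711TorusTransport (iterBlockOf_blockSiteK iterBlockOf_shift_blockSiteK)
open BIJ85Eq454PlaqResidual (resE)
open BIJ85ResidualConstants (offK offK_blockSiteK offK_shift_of_ne QestarIter_apply_offK)
open BIJ85Claim73Closed (dPlaq dPlaq_curl)
-- inside this namespace the bare `Site`/`Plaq` are the `ℤ^d` carriers of the QFT root; the torus ones are renamed:
open Balaban1983to89 renaming Site → TSite, Plaq → TPlaq

noncomputable section

variable {P : Params} {k : ℕ}

/-! ## §1  The cube functional `(dF)_{012}(x₀)` kills the projected part -/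

/-- `d` is additive: `d(F − F′) = dF − dF′`. [cite: BalabanImbrieJaffe1985, p.326 (text)] -/
theorem dPlaq_sub {j : ℕ} (g g' : TPlaq P j → ℝ) (x : TSite P j) {μ ν lam : Fin P.d} (hμν : μ < ν) (hνl : ν < lam) :
    dPlaq (g - g') x hμν hνl = dPlaq g x hμν hνl - dPlaq g' x hμν hνl := by
  simp only [dPlaq, Pi.sub_apply]
  ring

/-- `|(dF)_{μνλ}(x)|` is at most the sum of the six face values. [cite: BalabanImbrieJaffe1985, p.326 (text)] -/
theorem abs_dPlaq_le {j : ℕ} (g : TPlaq P j → ℝ) (x : TSite P j) {μ ν lam : Fin P.d} (hμν : μ < ν) (hνl : ν < lam) :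
    |dPlaq g x hμν hνl| ≤
      |g ⟨x.shift μ, ν, lam, hνl⟩| + |g ⟨x, ν, lam, hνl⟩| + |g ⟨x.shift ν, μ, lam, hμν.trans hνl⟩| +
        |g ⟨x, μ, lam, hμν.trans hνl⟩| + |g ⟨x.shift lam, μ, ν, hμν⟩| + |g ⟨x, μ, ν, hμν⟩| := by
  unfold dPlaq
  have h1 := abs_sub (g ⟨x.shift μ, ν, lam, hνl⟩) (g ⟨x, ν, lam, hνl⟩)
  have h2 := abs_sub (g ⟨x.shift ν, μ, lam, hμν.trans hνl⟩) (g ⟨x, μ, lam, hμν.trans hνl⟩)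
  have h3 := abs_sub (g ⟨x.shift lam, μ, ν, hμν⟩) (g ⟨x, μ, ν, hμν⟩)
  have h4 := abs_sub (g ⟨x.shift μ, ν, lam, hνl⟩ - g ⟨x, ν, lam, hνl⟩)
    (g ⟨x.shift ν, μ, lam, hμν.trans hνl⟩ - g ⟨x, μ, lam, hμν.trans hνl⟩)
  have h5 := abs_add_le ((g ⟨x.shift μ, ν, lam, hνl⟩ - g ⟨x, ν, lam, hνl⟩) -
    (g ⟨x.shift ν, μ, lam, hμν.trans hνl⟩ - g ⟨x, μ, lam, hμν.trans hνl⟩)) (g ⟨x.shift lam, μ, ν, hμν⟩ - g ⟨x, μ, ν, hμν⟩)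
  linarith

/-- `√w·∂_cA = ∂_{√w·c}A`. [cite: BalabanImbrieJaffe1985, (4.1.1) p.309] -/
theorem sqrt_mul_curl (w c : ℝ) (A : VecField P 0 ℝ) (p : TPlaq P 0) :
    Real.sqrt w * curl c A p = curl (Real.sqrt w * c) A p := by
  simp only [curl, smul_eq_mul]
  ring

/-- **`d` KILLS THE PROJECTED PART**: `∂G_{k,Ax}∂^*X` is a curl (`curlG_mem_range`), hence closed: `d(∂G_{k,Ax}∂^*X) = 0` on every cube.
[cite: BalabanImbrieJaffe1985, (4.2.6) p.311] -/
theorem dPlaq_curlG_eq_zero (w c : ℝ) (X : PlaqSpace P) (x : TSite P 0) {μ ν lam : Fin P.d} (hμν : μ < ν) (hνl : ν < lam) :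
    dPlaq (fun p => curlG (V411 P k) (curlOp (P := P) w c) X p) x hμν hνl = 0 := by
  obtain ⟨v, hv⟩ := curlG_mem_range (V411 P k) (curlOp (P := P) w c) X
  have h : (fun p => curlG (V411 P k) (curlOp (P := P) w c) X p) = curl (Real.sqrt w * c) ((toE P).symm v) := by
    funext p
    rw [hv, ← sqrt_mul_curl]
    rfl
  rw [h]
  exact dPlaq_curl _ _ x hμν hνl

/-- Hence **`d f_k(F) = d Q^{e*}_kF`** on every cube: the residual field has the same lattice exterior derivative as `Q^{e*}_kF`.
[cite: BalabanImbrieJaffe1985, (4.2.6) p.311] -/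
theorem dPlaq_resE (hd : 2 ≤ P.d) (w c : ℝ) (F : UnitPlaqSpace P k) (x : TSite P 0) {μ ν lam : Fin P.d} (hμν : μ < ν)
    (hνl : ν < lam) :
    dPlaq (fun p => resE hd w c k F p) x hμν hνl = dPlaq (fun p => QesOp (P := P) hd w k F p) x hμν hνl := by
  have h : (fun p => resE hd w c k F p) =
      (fun p => QesOp (P := P) hd w k F p) - fun p => curlG (V411 P k) (curlOp (P := P) w c) (QesOp (P := P) hd w k F) p := by
    funext p; simp only [resE, PiLp.sub_apply, Pi.sub_apply]
  rw [h, dPlaq_sub, dPlaq_curlG_eq_zero, sub_zero]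

/-! ## §2  `(dQ^{e*}_kδ_q)_{012}` at the corner cube of the block -/

section ThreeDirections

variable (hd3 : 3 ≤ P.d)

/-- With all in-block offsets equal to `L^k − 1`, the block point `x₀ = L^k·y + (L^k − 1, …, L^k − 1)` is the far corner of `B^k(y)`.
[cite: BalabanImbrieJaffe1985, (2.22) p.305] -/
theorem offK_corner (hk : k ≤ P.m + P.K) (y : TSite P k) (κ : Fin P.d) :
    offK k (blockSiteK k y fun _ => ⟨P.L ^ k - 1, Nat.sub_lt (pow_pos P.L_pos k) one_pos⟩) κ + 1 = P.L ^ k := by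
  rw [offK_blockSiteK hk]
  have := pow_pos P.L_pos k
  simp only
  omega

/-- A unit site is moved by a shift (the unit tori have `N_k = 2L^{m+K−k} ≥ 2` sites per direction). [cite: BalabanImbrieJaffe1985, (2.1) p.304] -/
theorem shift_ne_self {j : ℕ} (y : TSite P j) (κ : Fin P.d) : y.shift κ ≠ y := by
  intro h
  have h1 : y κ + 1 = y κ := by
    have := congrFun h κ
    simp only [Balaban1983to89.Site.shift, Function.update_self] at this
    exact this
  have h2 : (1 : ZMod (P.sitesPerDir j)) = 0 := add_left_cancel (h1.trans (add_zero _).symm)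
  have h3 := congrArg ZMod.val h2
  rw [ZMod.val_one_eq_one_mod, ZMod.val_zero] at h3
  have h4 : P.sitesPerDir j = 2 * P.L ^ (P.m + P.K - j) := rfl
  have h5 := pow_pos P.L_pos (P.m + P.K - j)
  rw [Nat.mod_eq_of_lt (by omega)] at h3
  exact one_ne_zero h3

/-- **THE FLUX OF `Q^{e*}_kδ_q` THROUGH THE CORNER CUBE**: for the unit field `δ_q`, `q = (y; 0, 1)`, and the fine cube at the far corner
`x₀` of `B^k(y)` spanned by the directions `0 < 1 < 2` (`d ≥ 3`): `(d(√w·Q^{e*}_kδ_q))_{012}(x₀) = −√w·L^{2k}` — of the six faces only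
`(x₀; 0, 1)` (a junction plaquette of `q`, value `L^{2k}`) and `(x₀ + e₂; 0, 1)` (a junction plaquette of the NEXT block `y + e₂`, value `0`)
are of type `(01)`. [cite: BalabanImbrieJaffe1985, (2.22) p.305] -/
theorem dPlaq_QesOp_single (hd : 2 ≤ P.d) (hk : k ≤ P.m + P.K) (w : ℝ) (y : TSite P k) :
    dPlaq (fun p => QesOp (P := P) hd w k (toU P k (Pi.single (⟨y, ⟨0, by omega⟩, ⟨1, by omega⟩, by simp [Fin.lt_def]⟩ : TPlaq P k) 1)) p)
      (blockSiteK k y fun _ => ⟨P.L ^ k - 1, Nat.sub_lt (pow_pos P.L_pos k) one_pos⟩)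
      (show (⟨0, by omega⟩ : Fin P.d) < ⟨1, by omega⟩ by simp [Fin.lt_def])
      (show (⟨1, by omega⟩ : Fin P.d) < ⟨2, by omega⟩ by simp [Fin.lt_def]) =
      -(Real.sqrt w * ((P.L : ℝ) ^ k) ^ 2) := by
  set q : TPlaq P k := ⟨y, ⟨0, by omega⟩, ⟨1, by omega⟩, by simp [Fin.lt_def]⟩ with hq
  set x₀ : TSite P 0 := blockSiteK k y fun _ => ⟨P.L ^ k - 1, Nat.sub_lt (pow_pos P.L_pos k) one_pos⟩ with hx₀
  have hX : ∀ p : TPlaq P 0, QesOp (P := P) hd w k (toU P k (Pi.single q 1)) p =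
      Real.sqrt w * (if offK k p.src p.μ + 1 = P.L ^ k ∧ offK k p.src p.ν + 1 = P.L ^ k then
        ((P.L : ℝ) ^ k) ^ 2 * (Pi.single q (1 : ℝ) : TPlaq P k → ℝ) ⟨iterBlockOf k p.src, p.μ, p.ν, p.hμν⟩ else 0) := by
    intro p
    rw [QesOp_apply, QestarIter_apply_offK hd hk]
    rfl
  -- faces of type `(1,2)` and `(0,2)` carry nothing (`δ_q` lives on type `(0,1)`)
  have h12 : ∀ (x : TSite P 0), QesOp (P := P) hd w k (toU P k (Pi.single q 1))
      ⟨x, ⟨1, by omega⟩, ⟨2, by omega⟩, show (⟨1, by omega⟩ : Fin P.d) < ⟨2, by omega⟩ by simp [Fin.lt_def]⟩ = 0 := by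
    intro x
    rw [hX]
    split_ifs
    · rw [Pi.single_apply, if_neg, mul_zero, mul_zero]
      rw [hq]; intro h; have := congrArg Balaban1983to89.Plaq.μ h; simp at this
    · rw [mul_zero]
  have h02 : ∀ (x : TSite P 0), QesOp (P := P) hd w k (toU P k (Pi.single q 1))
      ⟨x, ⟨0, by omega⟩, ⟨2, by omega⟩, show (⟨0, by omega⟩ : Fin P.d) < ⟨2, by omega⟩ by simp [Fin.lt_def]⟩ = 0 := by
    intro x
    rw [hX]
    split_ifs
    · rw [Pi.single_apply, if_neg, mul_zero, mul_zero]
      rw [hq]; intro h; have := congrArg Balaban1983to89.Plaq.ν h; simp at this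
    · rw [mul_zero]
  -- the `(0,1)` face at the corner: a junction plaquette of `q`
  have hA : QesOp (P := P) hd w k (toU P k (Pi.single q 1)) ⟨x₀, ⟨0, by omega⟩, ⟨1, by omega⟩, by simp [Fin.lt_def]⟩ =
      Real.sqrt w * ((P.L : ℝ) ^ k) ^ 2 := by
    rw [hX]
    dsimp only
    rw [if_pos ⟨offK_corner hk y _, offK_corner hk y _⟩, hx₀, iterBlockOf_blockSiteK hk, ← hq, Pi.single_eq_same, mul_one]
  -- the `(0,1)` face above the corner: a junction plaquette of the next block `y + e₂`, where `δ_q` vanishes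
  have hB : QesOp (P := P) hd w k (toU P k (Pi.single q 1))
      ⟨x₀.shift ⟨2, by omega⟩, ⟨0, by omega⟩, ⟨1, by omega⟩, by simp [Fin.lt_def]⟩ = 0 := by
    rw [hX]
    dsimp only
    have hne0 : (⟨0, by omega⟩ : Fin P.d) ≠ ⟨2, by omega⟩ := by simp
    have hne1 : (⟨1, by omega⟩ : Fin P.d) ≠ ⟨2, by omega⟩ := by simp
    have h1 : 1 ≤ P.L ^ k := pow_pos P.L_pos k
    have h1' : P.L ^ k - 1 + 1 = P.L ^ k := Nat.sub_add_cancel h1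
    rw [offK_shift_of_ne _ hne0, offK_shift_of_ne _ hne1, if_pos ⟨offK_corner hk y _, offK_corner hk y _⟩, hx₀,
      iterBlockOf_shift_blockSiteK hk, Fin.val_mk, if_pos h1', Pi.single_apply, if_neg, mul_zero, mul_zero]
    rw [hq]
    intro h
    exact shift_ne_self y _ (congrArg Balaban1983to89.Plaq.src h)
  simp only [dPlaq, h12, h02, hA, hB]
  ring

end ThreeDirections

/-! ## §3  The lower bound -/

/-- **THE RESIDUAL FIELD OF A SINGLE UNIT PLAQUETTE IS LARGE**: for `d ≥ 3`, `k ≤ m + K`, the unit field `δ_q` (`q = (y; 0, 1)`, `max|δ_q| = 1`)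
has `|f_k(δ_q)(p)| ≥ L^{2k}/6` at one of the six faces of the corner cube — in the Euclidean encoding `|resE(δ_q)(p)| ≥ √w·L^{2k}/6`
(any `w`, any curl factor `c`). [cite: BalabanImbrieJaffe1985, (4.2.6) p.311] -/
theorem exists_abs_resE_single_ge (hd : 2 ≤ P.d) (hd3 : 3 ≤ P.d) (hk : k ≤ P.m + P.K) (w c : ℝ) (y : TSite P k) :
    ∃ p : TPlaq P 0, Real.sqrt w * ((P.L : ℝ) ^ k) ^ 2 / 6 ≤
      |resE hd w c k (toU P k (Pi.single (⟨y, ⟨0, by omega⟩, ⟨1, by omega⟩, by simp [Fin.lt_def]⟩ : TPlaq P k) 1)) p| := by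
  set F : UnitPlaqSpace P k := toU P k (Pi.single (⟨y, ⟨0, by omega⟩, ⟨1, by omega⟩, by simp [Fin.lt_def]⟩ : TPlaq P k) 1)
    with hF
  set x₀ : TSite P 0 := blockSiteK k y fun _ => ⟨P.L ^ k - 1, Nat.sub_lt (pow_pos P.L_pos k) one_pos⟩ with hx₀
  have h01 : (⟨0, by omega⟩ : Fin P.d) < ⟨1, by omega⟩ := by simp [Fin.lt_def]
  have h12 : (⟨1, by omega⟩ : Fin P.d) < ⟨2, by omega⟩ := by simp [Fin.lt_def]
  have hflux : dPlaq (fun p => resE hd w c k F p) x₀ h01 h12 = -(Real.sqrt w * ((P.L : ℝ) ^ k) ^ 2) := by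
    rw [dPlaq_resE, hF, hx₀]
    exact dPlaq_QesOp_single hd3 hd hk w y
  have hle := abs_dPlaq_le (fun p => resE hd w c k F p) x₀ h01 h12
  rw [hflux, abs_neg, abs_of_nonneg (by positivity)] at hle
  by_contra hcon
  simp only [not_exists, not_le] at hcon
  have b1 := hcon ⟨x₀.shift ⟨0, by omega⟩, ⟨1, by omega⟩, ⟨2, by omega⟩, h12⟩
  have b2 := hcon ⟨x₀, ⟨1, by omega⟩, ⟨2, by omega⟩, h12⟩
  have b3 := hcon ⟨x₀.shift ⟨1, by omega⟩, ⟨0, by omega⟩, ⟨2, by omega⟩, h01.trans h12⟩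
  have b4 := hcon ⟨x₀, ⟨0, by omega⟩, ⟨2, by omega⟩, h01.trans h12⟩
  have b5 := hcon ⟨x₀.shift ⟨2, by omega⟩, ⟨0, by omega⟩, ⟨1, by omega⟩, h01⟩
  have b6 := hcon ⟨x₀, ⟨0, by omega⟩, ⟨1, by omega⟩, h01⟩
  linarith

/-- **NO `k`-UNIFORM RESIDUAL BOUND OVER ALL UNIT FIELDS**: if a constant `K` bounds the residual field of EVERY unit plaquette field at scale
`k`, `|resE(g)(p)| ≤ √w·K·max|g|` (`w > 0`, `d ≥ 3`, `k ≤ m + K`), then `K ≥ L^{2k}/6`. [cite: BalabanImbrieJaffe1985, (4.2.6) p.311] -/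
theorem sq_le_of_resBound_all (hd : 2 ≤ P.d) (hd3 : 3 ≤ P.d) (hk : k ≤ P.m + P.K) {w : ℝ} (hw : 0 < w) (c : ℝ) {K : ℝ}
    (hK : ∀ (g : TPlaq P k → ℝ) (C : ℝ), (∀ q, |g q| ≤ C) → ∀ p : TPlaq P 0,
      |resE hd w c k (toU P k g) p| ≤ Real.sqrt w * K * C) :
    ((P.L : ℝ) ^ k) ^ 2 / 6 ≤ K := by
  obtain ⟨p, hp⟩ := exists_abs_resE_single_ge hd hd3 hk w c (fun _ => 0 : TSite P k)
  have h1 := hK (Pi.single (⟨fun _ => 0, ⟨0, by omega⟩, ⟨1, by omega⟩, by simp [Fin.lt_def]⟩ : TPlaq P k) 1) 1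
    (fun q' => by rw [Pi.single_apply]; split_ifs <;> simp) p
  have hsw := Real.sqrt_pos.2 hw
  have h2 := hp.trans h1
  by_contra hcon
  have h3 : Real.sqrt w * K < Real.sqrt w * (((P.L : ℝ) ^ k) ^ 2 / 6) := mul_lt_mul_of_pos_left (lt_of_not_ge hcon) hsw
  linarith

/-- **The same in p33's normalisation** (`w = η^d`, `c = η⁻¹`; the shape of `BIJ85Claim73Residual.ResIdx.hR`): a constant `K` with
`|resE(g)(p)| ≤ K·√(η^d)·max|g|` for ALL unit fields `g` at scale `k` has `K ≥ L^{2k}/6` — so for an index `i : ResIdx d K`,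
`L^{2·i.k} ≤ 6K`: the all-field form of the located input is not uniform in `k` (`d ≥ 3`), the closed-field form
(`BIJ85Claim73Closed.ClosedIdx.hR`, `BIJ85ResidualSupBound`) is. [cite: BalabanImbrieJaffe1985, (7.3.1) p.326] -/
theorem sq_le_of_resBound_all_eta (hd : 2 ≤ P.d) (hd3 : 3 ≤ P.d) (hk : k ≤ P.m + P.K) {K : ℝ}
    (hK : ∀ (g : TPlaq P k → ℝ) (C : ℝ), (∀ q, |g q| ≤ C) → ∀ p : TPlaq P 0,
      |resE hd ((P.eta k) ^ P.d) (P.eta k)⁻¹ k (toU P k g) p| ≤ K * Real.sqrt ((P.eta k) ^ P.d) * C) :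
    ((P.L : ℝ) ^ k) ^ 2 / 6 ≤ K :=
  sq_le_of_resBound_all hd hd3 hk (pow_pos (eta_pos P k) _) (P.eta k)⁻¹ fun g C hg p => by
    rw [mul_comm (Real.sqrt _) K]; exact hK g C hg p

/-- **Applied to p33's all-field index**: every `i : ResIdx d K` has `L^{2·k} ≤ 6K` (`d ≥ 3`). [cite: BalabanImbrieJaffe1985, (7.3.1) p.326] -/
theorem ResIdx.sq_le {d : ℕ} {K : ℝ} (i : BIJ85Claim73Residual.ResIdx d K) (hd3 : 3 ≤ i.P.d) :
    ((i.P.L : ℝ) ^ i.k) ^ 2 / 6 ≤ K :=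
  sq_le_of_resBound_all_eta i.hd2 hd3 i.hk i.hR

end

end Literature.MathematicalPhysics.QuantumFieldTheory.BalabanImbrieJaffe1984to88.BIJ85ResidualNonClosed
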